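import Summits.CriticalPhenomena.SAWScalingLimit.Theorems.SAWDevelopingMapObservableToSLETypeLadderCarvedReductionSqueezeGateStructure
import Summits.CriticalPhenomena.SAWScalingLimit.Theorems.SAWDevelopingMapObservableToSLETypeLadderCarvedReductionSqueezeGateBounds
import Summits.CriticalPhenomena.SAWScalingLimit.Theorems.SAWDefectDecoherenceObservableToSLERNestedLinkDefs
import HarnessLib

/-!
# A continuum path of the limit bulk between the two windows, from the WIDE LINK
# (piece (T-A′₂ path) of stub T-A′₂ `stub_carvedReduction_squeezeGeometry_domainsCore`)

Crux `SAWDevelopingMap.ObservableToSLE` (stmt-CriticalPhenomena-10472), line `six-class-type-ladder`,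
stub T-A′₂ `stub_carvedReduction_squeezeGeometry_domainsCore`.  Landing target:
`Summits/CriticalPhenomena/SAWScalingLimit/Theorems/SAWDevelopingMapObservableToSLETypeLadderCarvedReductionSqueezeBulkPath.lean`.

The limit bulk `Ω` of the squeeze is the component of `b₀ = P₀ + (ρ/4) i` in `(D - τ) ∖ X`, `X`
the closed limit structure; the twin's inner-approximant contract (p144792) needs both windows
and the far part of `D - τ` inside `Ω`, i.e. continuum paths in `(D - τ) ∖ X` from `b₀` to
`b₁ = P₁ + (ρ/4) i`.  Lattice walks are useless (necks close in the limit); the input is the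
`ρ/4`-WIDE LINK of the gate pair (`NestedGate.WideLink`, hypothesis of T-A) at ONE late level:
* `mem_of_below_gate` — in an exact window every vertex rescaled into the window ball strictly
  below the gate height is removed;
* `cap_of_wideStart` — the start `x` of a wide link (`dist x (s c_q) ≤ ρ`, `ρ/4`-far from the
  removed vertices) lies in the CAP `im x ≥ im (s c_q) + ρ/4 - 14 s` (the removed lower half of
  the window ball of radius `ρ` pushes it up; needs `56 s < ρ`);
* `segment_margins` — hence every point of the segment from `x` to the window point
  `s c_q + (ρ/4) i` keeps its closed `ρ/16`-ball inside the domain and stays `ρ/16`-far from the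
  removed vertices (`112 s ≤ ρ`);
* `bulkPath_joinedIn` — THE PATH: if every point of `X` is eventually `ρ/32`-close to a pinned
  removed vertex (the covering half of `TypeLadder` piece LimitCover), then
  `JoinedIn (((· - τ) '' D) ∖ X) (P₀ + (ρ/4) i) (P₁ + (ρ/4) i)` (window segments + wide link at a
  late level, pinned; margins `ρ/16 > ρ/32 + |τ_j - τ|`).
Registered carrier: `stub_carvedReduction_bulkPath`.
-/

noncomputable section

open scoped Topology
open Filter Set Metric
open Literature.Probability.LatticeModels (HexVertex hexGraph hexCenter triEmbed Site)
open Literature.Probability.RandomPlanarGeometry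

namespace Summit.CriticalPhenomena.SAWScalingLimit.Theorems.ObservableToSLE.TypeLadder

open Summit.CriticalPhenomena.SAWScalingLimit.Theorems.ObservableToSLE.FloorRatio (row_le_iff_im)
open Summit.CriticalPhenomena.SAWScalingLimit.Theorems.ObservableToSLER.BridgeGate
open Summit.CriticalPhenomena.SAWScalingLimit.Theorems.ObservableToSLER.NestedGate

/-! ### One level: the cap of a wide start and the window segment -/

section Level

variable {t ρ : ℝ} {U : Set HexVertex} {q : HexVertex} {Ω₀ : Set ℂ}

/-- The height of the rescaled up-face `q` (`q.2 = 0`) is `(q.1 1 + 1/3) · t√3/2`. -/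
theorem im_smul_hexCenter_of_snd_eq_zero (t : ℝ) {q : HexVertex} (hq : q.2 = 0) :
    ((t : ℂ) * hexCenter q).im = ((q.1 1 : ℝ) + 1 / 3) * (t * (Real.sqrt 3 / 2)) := by
  have : q = ((q.1, 0) : HexVertex) := Prod.ext rfl hq
  rw [this, im_smul_hexCenter_upFace]

/-- **In an exact window, vertices rescaled into the window ball strictly below the gate height
are removed.** -/
theorem mem_of_below_gate (ht : 0 < t) (hq : q.2 = 0)
    (hwin : ∀ v : HexVertex, (t : ℂ) * hexCenter v ∈ ball ((t : ℂ) * hexCenter q) ρ → (v ∈ U ↔ v.1 1 < q.1 1))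
    {v : HexVertex} (hv : (t : ℂ) * hexCenter v ∈ ball ((t : ℂ) * hexCenter q) ρ)
    (him : ((t : ℂ) * hexCenter v).im < ((t : ℂ) * hexCenter q).im) : v ∈ U := by
  refine (hwin v hv).2 (lt_of_not_ge fun hle => ?_)
  have h1 := (row_le_iff_im ht (q.1 1) v).1 hle
  rw [← im_smul_hexCenter_of_snd_eq_zero t hq] at h1
  exact absurd him (not_lt.2 h1)

/-- **In an exact window, removed vertices rescaled into the window ball lie strictly below the
gate height.** -/
theorem im_lt_of_mem (ht : 0 < t) (hq : q.2 = 0)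
    (hwin : ∀ v : HexVertex, (t : ℂ) * hexCenter v ∈ ball ((t : ℂ) * hexCenter q) ρ → (v ∈ U ↔ v.1 1 < q.1 1))
    {v : HexVertex} (hv : (t : ℂ) * hexCenter v ∈ ball ((t : ℂ) * hexCenter q) ρ) (hvU : v ∈ U) :
    ((t : ℂ) * hexCenter v).im < ((t : ℂ) * hexCenter q).im := by
  rw [im_smul_hexCenter_of_snd_eq_zero t hq]
  exact im_lt_of_row_lt ht ((hwin v hv).1 hvU)

/-- **THE CAP OF A WIDE START.**  In an exact window of radius `ρ` at the up-face gate `q`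
(mesh `t`, `56 t < ρ`), a point `x` with `dist x (t c_q) ≤ ρ` which is `ρ/4`-far from every
removed vertex satisfies `im (t c_q) + ρ/4 - 14 t ≤ im x`: otherwise a lattice face `2t`-close
to the point of the window ball below `x` at height `im (t c_q) - 3 t` (after a radial
contraction by `9 t`) is removed and `ρ/4`-close to `x`. -/
theorem cap_of_wideStart (ht : 0 < t) (hρ : 56 * t < ρ) (hq : q.2 = 0)
    (hwin : ∀ v : HexVertex, (t : ℂ) * hexCenter v ∈ ball ((t : ℂ) * hexCenter q) ρ → (v ∈ U ↔ v.1 1 < q.1 1))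
    {x : ℂ} (hx : dist x ((t : ℂ) * hexCenter q) ≤ ρ) (hfar : ∀ v ∈ U, ρ / 4 ≤ dist x ((t : ℂ) * hexCenter v)) :
    ((t : ℂ) * hexCenter q).im + ρ / 4 - 14 * t ≤ x.im := by
  set Q : ℂ := (t : ℂ) * hexCenter q with hQ
  by_contra hcap
  push Not at hcap
  have hρ0 : 0 < ρ := by linarith
  -- radial contraction by the factor `1 - 9t/ρ`
  set c : ℝ := 9 * t / ρ with hc
  have hc0 : 0 < c := by positivity
  have hc1 : c < 1 := by rw [hc, div_lt_one hρ0]; linarith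
  have hcρ : c * ρ = 9 * t := by rw [hc]; field_simp
  set x' : ℂ := Q + ((1 - c : ℝ) : ℂ) * (x - Q) with hx'
  have hx'Q : dist x' Q ≤ ρ - 9 * t := by
    have : x' - Q = ((1 - c : ℝ) : ℂ) * (x - Q) := by rw [hx']; ring
    rw [dist_eq_norm, this, norm_mul, Complex.norm_real, Real.norm_eq_abs, abs_of_pos (by linarith),
      ← dist_eq_norm]
    nlinarith [dist_nonneg (x := x) (y := Q)]
  have hxx' : dist x x' ≤ 9 * t := by
    have : x - x' = ((c : ℝ) : ℂ) * (x - Q) := by rw [hx']; push_cast; ring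
    rw [dist_eq_norm, this, norm_mul, Complex.norm_real, Real.norm_eq_abs, abs_of_pos hc0, ← dist_eq_norm]
    nlinarith [dist_nonneg (x := x) (y := Q)]
  have him' : x'.im - Q.im ≤ max 0 (x.im - Q.im) := by
    have e : x'.im - Q.im = (1 - c) * (x.im - Q.im) := by
      simp only [hx', Complex.add_im, Complex.mul_im, Complex.ofReal_re, Complex.ofReal_im, Complex.sub_im]
      ring
    rw [e]
    rcases le_or_gt 0 (x.im - Q.im) with h | h
    · calc (1 - c) * (x.im - Q.im) ≤ 1 * (x.im - Q.im) := mul_le_mul_of_nonneg_right (by linarith) h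
        _ ≤ max 0 (x.im - Q.im) := by rw [one_mul]; exact le_max_right _ _
    · exact (le_max_left _ _).trans' (by nlinarith)
  -- the point below `x'` at height `im Q - 3t`
  set y₀ : ℂ := ⟨x'.re, min x'.im (Q.im - 3 * t)⟩ with hy₀
  have hy₀x' : dist x' y₀ ≤ max 0 (x.im - Q.im) + 3 * t := by
    rw [Complex.dist_of_re_eq (show x'.re = y₀.re by rw [hy₀]), Real.dist_eq]
    have e : y₀.im = min x'.im (Q.im - 3 * t) := by rw [hy₀]
    rw [e, abs_of_nonneg (sub_nonneg.2 (min_le_left _ _))]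
    rcases le_total x'.im (Q.im - 3 * t) with h | h
    · rw [min_eq_left h]; linarith [le_max_left 0 (x.im - Q.im)]
    · rw [min_eq_right h]; linarith
  have hy₀Q : dist y₀ Q < ρ - 2 * t := by
    have hsq : dist x' Q ^ 2 = (x'.re - Q.re) ^ 2 + (x'.im - Q.im) ^ 2 := by
      rw [Complex.dist_eq_re_im, Real.sq_sqrt (by positivity)]
    have hy : dist y₀ Q ^ 2 = (x'.re - Q.re) ^ 2 + (min x'.im (Q.im - 3 * t) - Q.im) ^ 2 := by
      rw [Complex.dist_eq_re_im, Real.sq_sqrt (by positivity), hy₀]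
    have hmin : (min x'.im (Q.im - 3 * t) - Q.im) ^ 2 ≤ (x'.im - Q.im) ^ 2 + 9 * t ^ 2 := by
      rcases le_total x'.im (Q.im - 3 * t) with h | h
      · rw [min_eq_left h]; nlinarith
      · rw [min_eq_right h]; nlinarith
    have h1 : dist y₀ Q ^ 2 < (ρ - 2 * t) ^ 2 := by
      have h2 : dist x' Q ^ 2 ≤ (ρ - 9 * t) ^ 2 := pow_le_pow_left₀ dist_nonneg hx'Q 2
      nlinarith
    have := abs_lt_of_sq_lt_sq h1 (by linarith)
    rwa [abs_of_nonneg dist_nonneg] at this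
  have hy₀im : y₀.im ≤ Q.im - 3 * t := by rw [hy₀]; exact min_le_right _ _
  -- the nearest lattice face is removed and too close to `x`
  obtain ⟨v, hv⟩ := exists_vertex_near y₀ ht
  have hv' : dist y₀ ((t : ℂ) * hexCenter v) ≤ 2 * t := by rwa [dist_comm] at hv
  have hvball : (t : ℂ) * hexCenter v ∈ ball Q ρ := by
    rw [mem_ball]
    calc dist ((t : ℂ) * hexCenter v) Q ≤ dist ((t : ℂ) * hexCenter v) y₀ + dist y₀ Q := dist_triangle _ _ _
      _ < 2 * t + (ρ - 2 * t) := add_lt_add_of_le_of_lt hv hy₀Q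
      _ = ρ := by ring
  have hvim : ((t : ℂ) * hexCenter v).im < Q.im := by
    have h1 := Complex.abs_im_le_norm ((t : ℂ) * hexCenter v - y₀)
    rw [← dist_eq_norm, Complex.sub_im] at h1
    linarith [le_abs_self (((t : ℂ) * hexCenter v).im - y₀.im)]
  have hvU : v ∈ U := mem_of_below_gate ht hq hwin hvball hvim
  have h1 := hfar v hvU
  have h2 : dist x ((t : ℂ) * hexCenter v) ≤ 14 * t + max 0 (x.im - Q.im) :=
    calc dist x ((t : ℂ) * hexCenter v) ≤ dist x x' + dist x' y₀ + dist y₀ ((t : ℂ) * hexCenter v) :=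
          dist_triangle4 _ _ _ _
      _ ≤ 9 * t + (max 0 (x.im - Q.im) + 3 * t) + 2 * t := add_le_add (add_le_add hxx' hy₀x') hv'
      _ = 14 * t + max 0 (x.im - Q.im) := by ring
  rcases le_or_gt 0 (x.im - Q.im) with h | h
  · rw [max_eq_right h] at h2; linarith
  · rw [max_eq_left h.le] at h2; linarith

/-- **THE WINDOW SEGMENT OF A WIDE START.**  With `112 t ≤ ρ`, the exact window of radius `ρ` at
`q`, `closedBall (t c_q) ρ ⊆ Ω₀`, and a wide start `x` (`dist x (t c_q) ≤ ρ`,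
`closedBall x (ρ/4) ⊆ Ω₀`, `ρ/4`-far from the removed vertices): every point `z` of the segment
from `x` to the window point `t c_q + (ρ/4) i` has `closedBall z (ρ/16) ⊆ Ω₀` and is `ρ/16`-far
from every removed vertex. -/
theorem segment_margins (ht : 0 < t) (hρ : 112 * t ≤ ρ) (hq : q.2 = 0)
    (hwin : ∀ v : HexVertex, (t : ℂ) * hexCenter v ∈ ball ((t : ℂ) * hexCenter q) ρ → (v ∈ U ↔ v.1 1 < q.1 1))
    (hball : closedBall ((t : ℂ) * hexCenter q) ρ ⊆ Ω₀)
    {x : ℂ} (hx : dist x ((t : ℂ) * hexCenter q) ≤ ρ) (hxΩ : closedBall x (ρ / 4) ⊆ Ω₀)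
    (hfar : ∀ v ∈ U, ρ / 4 ≤ dist x ((t : ℂ) * hexCenter v)) {z : ℂ}
    (hz : z ∈ segment ℝ x ((t : ℂ) * hexCenter q + ((ρ / 4 : ℝ) : ℂ) * Complex.I)) :
    closedBall z (ρ / 16) ⊆ Ω₀ ∧ ∀ v ∈ U, ρ / 16 ≤ dist z ((t : ℂ) * hexCenter v) := by
  set Q : ℂ := (t : ℂ) * hexCenter q with hQ
  set c₀ : ℂ := Q + ((ρ / 4 : ℝ) : ℂ) * Complex.I with hc₀
  have hρ0 : 0 < ρ := by linarith
  have hcap : Q.im + ρ / 4 - 14 * t ≤ x.im := cap_of_wideStart ht (by linarith) hq hwin hx hfar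
  rw [segment_eq_image'] at hz
  obtain ⟨θ, ⟨hθ0, hθ1⟩, rfl⟩ := hz
  simp only [Complex.real_smul]
  set z : ℂ := x + (θ : ℂ) * (c₀ - x) with hzdef
  have hc₀Q : dist c₀ Q = ρ / 4 := by
    rw [dist_eq_norm, hc₀, add_sub_cancel_left, norm_mul, Complex.norm_real, Complex.norm_I, mul_one,
      Real.norm_eq_abs, abs_of_pos (by positivity)]
  have hc₀x : dist c₀ x ≤ 5 * ρ / 4 := by
    linarith [dist_triangle c₀ Q x, dist_comm x Q]
  have hzx : dist z x = θ * dist c₀ x := by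
    rw [dist_eq_norm, hzdef, add_sub_cancel_left, norm_mul, Complex.norm_real, Real.norm_eq_abs,
      abs_of_nonneg hθ0, ← dist_eq_norm]
  -- the height of `z`
  have hzim : Q.im + ρ / 8 ≤ z.im := by
    have e : z.im = x.im + θ * (c₀.im - x.im) := by rw [hzdef]; simp
    have hc₀im : c₀.im = Q.im + ρ / 4 := by rw [hc₀]; simp
    rw [e, hc₀im]
    nlinarith
  -- the distance of `z` to the window centre
  have hzQ : dist z Q ≤ (1 - θ) * dist x Q + θ * (ρ / 4) := by
    have e : z - Q = ((1 - θ : ℝ) : ℂ) * (x - Q) + (θ : ℂ) * (c₀ - Q) := by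
      rw [hzdef]; push_cast; ring
    rw [dist_eq_norm, e]
    refine (norm_add_le _ _).trans ?_
    rw [norm_mul, norm_mul, Complex.norm_real, Complex.norm_real, Real.norm_eq_abs, Real.norm_eq_abs,
      abs_of_nonneg (by linarith), abs_of_nonneg hθ0, ← dist_eq_norm, ← dist_eq_norm, hc₀Q]
  rcases le_or_gt (dist z x) (ρ / 8) with hnear | hfarx
  · -- near the start: inside `closedBall x (ρ/4)`, `ρ/8`-far from the removed vertices
    refine ⟨fun w hw => hxΩ ?_, fun v hv => ?_⟩
    · rw [mem_closedBall] at hw ⊢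
      linarith [dist_triangle w z x]
    · have := hfar v hv
      linarith [dist_triangle x z ((t : ℂ) * hexCenter v), dist_comm x z]
  · -- far from the start: `θ > 1/10`, so `z` is `3ρ/40`-deep in the window ball
    have hθ : 1 / 10 < θ := by
      by_contra hle
      push Not at hle
      have : dist z x ≤ 1 / 10 * (5 * ρ / 4) := by
        rw [hzx]; exact mul_le_mul hle hc₀x dist_nonneg (by norm_num)
      linarith
    have hzQ' : dist z Q < ρ - 3 * ρ / 40 := by
      have : (1 - θ) * dist x Q ≤ (1 - θ) * ρ := mul_le_mul_of_nonneg_left hx (by linarith)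
      nlinarith
    refine ⟨fun w hw => hball ?_, fun v hv => ?_⟩
    · rw [mem_closedBall] at hw ⊢
      linarith [dist_triangle w z Q]
    · by_cases hvb : (t : ℂ) * hexCenter v ∈ ball Q ρ
      · have hvim := im_lt_of_mem ht hq hwin hvb hv
        have h1 := Complex.abs_im_le_norm (z - (t : ℂ) * hexCenter v)
        rw [← dist_eq_norm, Complex.sub_im] at h1
        linarith [le_abs_self (z.im - ((t : ℂ) * hexCenter v).im)]
      · rw [mem_ball, not_lt] at hvb
        linarith [dist_triangle ((t : ℂ) * hexCenter v) z Q, dist_comm z ((t : ℂ) * hexCenter v)]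

end Level

/-! ### The path in the pinned frame -/

section Pinned

variable {s : ℕ → ℝ} {y : ℕ → Site 2} {U : ℕ → Set HexVertex} {q q' : ℕ → HexVertex} {Ω₀ X : Set ℂ}
  {ρ : ℝ} {τ P₀ P₁ : ℂ}

/-- **THE BULK PATH BETWEEN THE WINDOWS.**  Along meshes `s_j → 0` with pinning translations
`s_j · triEmbed y_j → τ`, exact windows of radius `ρ` at the up-face gates `q_j`, `q'_j` (window
balls inside `Ω₀`, pinned gates converging to `P₀`, `P₁`), a `ρ/4`-wide link of the gate pair at
every level, and a closed obstacle `X` every point of which is eventually `ρ/32`-close to a pinned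
removed vertex: the window points `P₀ + (ρ/4) i` and `P₁ + (ρ/4) i` are joined in
`((· - τ) '' Ω₀) ∖ X`. -/
theorem bulkPath_joinedIn (hρ : 0 < ρ) (hs : ∀ j, 0 < s j) (hs0 : Tendsto s atTop (𝓝 0))
    (hτ : Tendsto (fun j => (s j : ℂ) * triEmbed (y j)) atTop (𝓝 τ))
    (hq2 : ∀ j, (q j).2 = 0) (hq2' : ∀ j, (q' j).2 = 0)
    (hwin : ∀ j (v : HexVertex), (s j : ℂ) * hexCenter v ∈ ball ((s j : ℂ) * hexCenter (q j)) ρ →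
      (v ∈ U j ↔ v.1 1 < (q j).1 1))
    (hwin' : ∀ j (v : HexVertex), (s j : ℂ) * hexCenter v ∈ ball ((s j : ℂ) * hexCenter (q' j)) ρ →
      (v ∈ U j ↔ v.1 1 < (q' j).1 1))
    (hball : ∀ j, closedBall ((s j : ℂ) * hexCenter (q j)) ρ ⊆ Ω₀)
    (hball' : ∀ j, closedBall ((s j : ℂ) * hexCenter (q' j)) ρ ⊆ Ω₀)
    (hlink : ∀ j, WideLink Ω₀ (s j) ρ (U j) (q j) (q' j))
    (hconv : Tendsto (fun j => (s j : ℂ) * hexCenter (q j) - (s j : ℂ) * triEmbed (y j)) atTop (𝓝 P₀))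
    (hconv' : Tendsto (fun j => (s j : ℂ) * hexCenter (q' j) - (s j : ℂ) * triEmbed (y j)) atTop (𝓝 P₁))
    (hX : ∀ᶠ j in atTop, ∀ z ∈ X, ∃ v ∈ U j,
      dist ((s j : ℂ) * hexCenter v - (s j : ℂ) * triEmbed (y j)) z < ρ / 32) :
    JoinedIn (((fun z => z - τ) '' Ω₀) \ X) (P₀ + ((ρ / 4 : ℝ) : ℂ) * Complex.I)
      (P₁ + ((ρ / 4 : ℝ) : ℂ) * Complex.I) := by
  set G : Set ℂ := ((fun z => z - τ) '' Ω₀) \ X with hG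
  set I4 : ℂ := ((ρ / 4 : ℝ) : ℂ) * Complex.I with hI4
  have h1 : ∀ᶠ j in atTop, dist ((s j : ℂ) * triEmbed (y j)) τ < ρ / 64 := Metric.tendsto_nhds.1 hτ _ (by positivity)
  have h2 : ∀ᶠ j in atTop, dist ((s j : ℂ) * hexCenter (q j) - (s j : ℂ) * triEmbed (y j)) P₀ < ρ / 64 :=
    Metric.tendsto_nhds.1 hconv _ (by positivity)
  have h3 : ∀ᶠ j in atTop, dist ((s j : ℂ) * hexCenter (q' j) - (s j : ℂ) * triEmbed (y j)) P₁ < ρ / 64 :=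
    Metric.tendsto_nhds.1 hconv' _ (by positivity)
  have h4 : ∀ᶠ j in atTop, 112 * s j < ρ := by
    have : Tendsto (fun j => 112 * s j) atTop (𝓝 (112 * 0)) := hs0.const_mul 112
    rw [mul_zero] at this
    exact this.eventually (gt_mem_nhds hρ)
  obtain ⟨j, hj1, hj2, hj3, hj4, hjX⟩ := (h1.and (h2.and (h3.and (h4.and hX)))).exists
  set t : ℝ := s j with htdef
  set σ : ℂ := (s j : ℂ) * triEmbed (y j) with hσ
  set Q : ℂ := (s j : ℂ) * hexCenter (q j) with hQ
  set Q' : ℂ := (s j : ℂ) * hexCenter (q' j) with hQ'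
  set V : Set ℂ := {z : ℂ | closedBall z (ρ / 16) ⊆ Ω₀ ∧ ∀ v ∈ U j, ρ / 16 ≤ dist z ((s j : ℂ) * hexCenter v)}
    with hV
  have hVG : (fun z => z - σ) '' V ⊆ G := by
    rintro _ ⟨z, ⟨hzΩ, hzU⟩, rfl⟩
    refine ⟨⟨z + (τ - σ), hzΩ ?_, by ring⟩, fun hzX => ?_⟩
    · rw [mem_closedBall, dist_eq_norm, add_sub_cancel_left, ← dist_eq_norm, dist_comm]; linarith
    · obtain ⟨v, hvU, hvz⟩ := hjX _ hzX
      have := hzU v hvU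
      have e : dist ((s j : ℂ) * hexCenter v - σ) (z - σ) = dist z ((s j : ℂ) * hexCenter v) := by
        rw [dist_comm, dist_eq_norm, dist_eq_norm]; congr 1; ring
      linarith [e ▸ hvz]
  obtain ⟨x, x', γ, hx, hx', hγ⟩ := hlink j
  have hx0 : closedBall x (ρ / 4) ⊆ Ω₀ ∧ ∀ v ∈ U j, ρ / 4 ≤ dist x ((s j : ℂ) * hexCenter v) := by
    have := hγ 0; rwa [γ.source] at this
  have hx1 : closedBall x' (ρ / 4) ⊆ Ω₀ ∧ ∀ v ∈ U j, ρ / 4 ≤ dist x' ((s j : ℂ) * hexCenter v) := by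
    have := hγ 1; rwa [γ.target] at this
  have hseg0 : segment ℝ x (Q + I4) ⊆ V := fun z hz =>
    segment_margins (hs j) hj4.le (hq2 j) (hwin j) (hball j) hx hx0.1 hx0.2 hz
  have hseg1 : segment ℝ x' (Q' + I4) ⊆ V := fun z hz =>
    segment_margins (hs j) hj4.le (hq2' j) (hwin' j) (hball' j) hx' hx1.1 hx1.2 hz
  have hγV : ∀ u, γ u ∈ V := fun u =>
    ⟨(closedBall_subset_closedBall (by linarith)).trans (hγ u).1, fun v hv => by linarith [(hγ u).2 v hv]⟩
  have hlevel : JoinedIn V (Q + I4) (Q' + I4) :=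
    ((JoinedIn.of_segment_subset hseg0).symm.trans ⟨γ, hγV⟩).trans (JoinedIn.of_segment_subset hseg1)
  have hpinned : JoinedIn G (Q + I4 - σ) (Q' + I4 - σ) :=
    (hlevel.map (continuous_sub_right σ)).mono hVG
  have hend : ∀ {Qg Pg : ℂ} {qg : HexVertex}, Qg = (s j : ℂ) * hexCenter qg → qg.2 = 0 →
      (∀ v : HexVertex, (s j : ℂ) * hexCenter v ∈ ball Qg ρ → (v ∈ U j ↔ v.1 1 < qg.1 1)) →
      closedBall Qg ρ ⊆ Ω₀ → dist (Qg - σ) Pg < ρ / 64 → ball (Pg + I4) (ρ / 32) ⊆ G := by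
    intro Qg Pg qg hQg hqg hwing hballg hdist z hz
    rw [mem_ball] at hz
    have hI4n : ‖I4‖ = ρ / 4 := by
      rw [hI4, norm_mul, Complex.norm_real, Complex.norm_I, mul_one, Real.norm_eq_abs, abs_of_pos (by positivity)]
    refine ⟨⟨z + τ, hballg ?_, by ring⟩, fun hzX => ?_⟩
    · rw [mem_closedBall]
      calc dist (z + τ) Qg ≤ dist (z + τ) (Pg + I4 + τ) + dist (Pg + I4 + τ) (Pg + σ) + dist (Pg + σ) Qg :=
            dist_triangle4 _ _ _ _
        _ ≤ ρ / 32 + (ρ / 4 + ρ / 64) + ρ / 64 := by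
            refine add_le_add (add_le_add ?_ ?_) ?_
            · rw [dist_eq_norm, show z + τ - (Pg + I4 + τ) = z - (Pg + I4) by ring, ← dist_eq_norm]; exact hz.le
            · rw [dist_eq_norm, show Pg + I4 + τ - (Pg + σ) = I4 + (τ - σ) by ring]
              refine (norm_add_le _ _).trans ?_
              rw [hI4n, ← dist_eq_norm, dist_comm]; linarith
            · rw [dist_eq_norm, show Pg + σ - Qg = -(Qg - σ - Pg) by ring, norm_neg, ← dist_eq_norm]; exact hdist.le
        _ ≤ ρ := by linarith
    · obtain ⟨v, hvU, hvz⟩ := hjX z hzX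
      have hvball : (s j : ℂ) * hexCenter v ∈ ball Qg ρ := by
        rw [mem_ball]
        calc dist ((s j : ℂ) * hexCenter v) Qg
            ≤ dist ((s j : ℂ) * hexCenter v) (z + σ) + dist (z + σ) (Pg + I4 + σ) + dist (Pg + I4 + σ) Qg :=
              dist_triangle4 _ _ _ _
          _ < ρ / 32 + ρ / 32 + (ρ / 4 + ρ / 64) := by
              refine add_lt_add_of_lt_of_le (add_lt_add ?_ ?_) ?_
              · rw [dist_eq_norm, show (s j : ℂ) * hexCenter v - (z + σ) = ((s j : ℂ) * hexCenter v - σ) - z by ring,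
                  ← dist_eq_norm]; exact hvz
              · rw [dist_eq_norm, show z + σ - (Pg + I4 + σ) = z - (Pg + I4) by ring, ← dist_eq_norm]; exact hz
              · rw [dist_eq_norm, show Pg + I4 + σ - Qg = I4 - (Qg - σ - Pg) by ring]
                refine (norm_sub_le _ _).trans ?_
                rw [hI4n, ← dist_eq_norm]; linarith
          _ ≤ ρ := by linarith
      have hvim := im_lt_of_mem (hs j) hqg (by rw [← hQg]; exact hwing) (by rw [← hQg]; exact hvball) hvU
      rw [← hQg] at hvim
      have e1 : ((s j : ℂ) * hexCenter v).im = ((s j : ℂ) * hexCenter v - σ).im + σ.im := by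
        simp only [Complex.sub_im]; ring
      have e2 : Qg.im = (Qg - σ - Pg).im + σ.im + Pg.im := by simp only [Complex.sub_im]; ring
      have h5 : |(Qg - σ - Pg).im| < ρ / 64 := by
        refine (Complex.abs_im_le_norm _).trans_lt ?_; rwa [← dist_eq_norm]
      have h6 : |(((s j : ℂ) * hexCenter v - σ) - z).im| < ρ / 32 := by
        refine (Complex.abs_im_le_norm _).trans_lt ?_; rwa [← dist_eq_norm]
      have h7 : |(z - (Pg + I4)).im| < ρ / 32 := by
        refine (Complex.abs_im_le_norm _).trans_lt ?_; rwa [← dist_eq_norm]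
      have hI4im : I4.im = ρ / 4 := by rw [hI4]; simp
      rw [Complex.sub_im] at h6 h7
      rw [Complex.add_im, hI4im] at h7
      rw [abs_lt] at h5 h6 h7
      linarith
  have hb₀ : ball (P₀ + I4) (ρ / 32) ⊆ G := hend hQ (hq2 j) (hwin j) (hball j) hj2
  have hb₁ : ball (P₁ + I4) (ρ / 32) ⊆ G := hend hQ' (hq2' j) (hwin' j) (hball' j) hj3
  have hstart : JoinedIn G (P₀ + I4) (Q + I4 - σ) := by
    refine JoinedIn.of_segment_subset ((convex_ball _ _).segment_subset (mem_ball_self (by positivity)) ?_ |>.trans hb₀)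
    rw [mem_ball, dist_eq_norm, show Q + I4 - σ - (P₀ + I4) = Q - σ - P₀ by ring, ← dist_eq_norm]
    linarith
  have hfinish : JoinedIn G (Q' + I4 - σ) (P₁ + I4) := by
    refine JoinedIn.of_segment_subset ((convex_ball _ _).segment_subset ?_ (mem_ball_self (by positivity)) |>.trans hb₁)
    rw [mem_ball, dist_eq_norm, show Q' + I4 - σ - (P₁ + I4) = Q' - σ - P₁ by ring, ← dist_eq_norm]
    linarith
  exact (hstart.trans hpinned).trans hfinish

end Pinned

/-- **Registered carrier `stub_carvedReduction_bulkPath`** (crux item stmt-CriticalPhenomena-10472,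
stub T-A′₂ `stub_carvedReduction_squeezeGeometry_domainsCore`, piece THE BULK PATH FROM THE WIDE LINK):
registry form of `bulkPath_joinedIn`. -/
theorem stub_carvedReduction_bulkPath :
    ∀ (s : ℕ → ℝ) (y : ℕ → Site 2) (U : ℕ → Set HexVertex) (q q' : ℕ → HexVertex) (Ω₀ X : Set ℂ)
      (ρ : ℝ) (τ P₀ P₁ : ℂ), 0 < ρ → (∀ j, 0 < s j) → Tendsto s atTop (𝓝 0) →
      Tendsto (fun j => (s j : ℂ) * triEmbed (y j)) atTop (𝓝 τ) →
      (∀ j, (q j).2 = 0) → (∀ j, (q' j).2 = 0) →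
      (∀ j (v : HexVertex), (s j : ℂ) * hexCenter v ∈ ball ((s j : ℂ) * hexCenter (q j)) ρ →
        (v ∈ U j ↔ v.1 1 < (q j).1 1)) →
      (∀ j (v : HexVertex), (s j : ℂ) * hexCenter v ∈ ball ((s j : ℂ) * hexCenter (q' j)) ρ →
        (v ∈ U j ↔ v.1 1 < (q' j).1 1)) →
      (∀ j, closedBall ((s j : ℂ) * hexCenter (q j)) ρ ⊆ Ω₀) →
      (∀ j, closedBall ((s j : ℂ) * hexCenter (q' j)) ρ ⊆ Ω₀) →
      (∀ j, WideLink Ω₀ (s j) ρ (U j) (q j) (q' j)) →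
      Tendsto (fun j => (s j : ℂ) * hexCenter (q j) - (s j : ℂ) * triEmbed (y j)) atTop (𝓝 P₀) →
      Tendsto (fun j => (s j : ℂ) * hexCenter (q' j) - (s j : ℂ) * triEmbed (y j)) atTop (𝓝 P₁) →
      (∀ᶠ j in atTop, ∀ z ∈ X, ∃ v ∈ U j,
        dist ((s j : ℂ) * hexCenter v - (s j : ℂ) * triEmbed (y j)) z < ρ / 32) →
      JoinedIn (((fun z => z - τ) '' Ω₀) \ X) (P₀ + ((ρ / 4 : ℝ) : ℂ) * Complex.I)
        (P₁ + ((ρ / 4 : ℝ) : ℂ) * Complex.I) :=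
  fun _ _ _ _ _ _ _ _ _ _ _ hρ hs hs0 hτ hq2 hq2' hwin hwin' hball hball' hlink hconv hconv' hX =>
    bulkPath_joinedIn hρ hs hs0 hτ hq2 hq2' hwin hwin' hball hball' hlink hconv hconv' hX

end Summit.CriticalPhenomena.SAWScalingLimit.Theorems.ObservableToSLE.TypeLadder

end
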